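import Summits.AtomisticToContinuum.Crystallization.Theorems.FreeSplittingCertificatesStrictSplittingRuleP1CellMoments

/-!
# `StrictSplittingRule` (stmt-AtomisticToContinuum-12560): the four-point VARIANCE IDENTITY (Jensen with exact defect) for quadratic forms (P1 interpolant object, part 23)

Route `FreeSplittingCertificates`, crux r3 `StrictSplittingRule` (H12⋆ = `stub_coreJointCoercive`), unit b2b-freesplit-B gen 22.
VALUE = the algebraic identity behind BOTH demand-side comparisons of HOME FAR-LEMMA-SPEC §17 (c),(e): for barycentric weights
`λ₀+λ₁+λ₂+λ₃ = 1` and a symmetric `3×3` weight `W`,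
`Σ_i λ_i·(v_iᵀWv_i) − (Σ_iλ_iv_i)ᵀW(Σ_iλ_iv_i) = ½·Σ_{i,j} λ_iλ_j·(v_i−v_j)ᵀW(v_i−v_j)`
(`p1Quad3`, **`p1_variance_identity`**); hence for `W ⪰ 0` and `λ ≥ 0` the P1 value `ṽ = Σλ_iv_i` satisfies JENSEN `ṽᵀWṽ ≤ Σλ_i v_iᵀWv_i`
(`p1_jensen_quad`) and the defect is edge-difference (gradient) energy.  Specialisations: `|·|²` (`W = I`) and `⟪d,·⟫²` (`W = ddᵀ`).  Integrated over a
cell with parts 20–22 (`∫λ_i = |cell|/4`, `∫λ_iλ_j ≤ |cell|/16`) this is the vertex-quadrature excess bound.  NOT a proof of H12⋆, NOT summit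
progress.  [folklore]
-/

noncomputable section

open Set Function
open scoped BigOperators

namespace Summit.AtomisticToContinuum.Crystallization.Theorems.StrictSplittingRuleBirth

/-- The quadratic form of a `3×3` coefficient table on coordinate vectors: `vᵀWv = Σ_{k,l} W k l · v_k · v_l`. -/
def p1Quad3 (W : Fin 3 → Fin 3 → ℝ) (v : Fin 3 → ℝ) : ℝ :=
  ∑ k : Fin 3, ∑ l : Fin 3, W k l * v k * v l

/-- `p1Quad3` expanded. -/
theorem p1Quad3_eq (W : Fin 3 → Fin 3 → ℝ) (v : Fin 3 → ℝ) :
    p1Quad3 W v = W 0 0 * v 0 * v 0 + W 0 1 * v 0 * v 1 + W 0 2 * v 0 * v 2 + W 1 0 * v 1 * v 0 + W 1 1 * v 1 * v 1 + W 1 2 * v 1 * v 2 +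
      W 2 0 * v 2 * v 0 + W 2 1 * v 2 * v 1 + W 2 2 * v 2 * v 2 := by
  simp only [p1Quad3, Fin.sum_univ_three]
  ring

/-- **The four-point variance identity** (any `W`, symmetric or not; weights summing to `1`):
`Σ_i λ_i q(v_i) − q(Σ_i λ_i v_i) = ½ Σ_i Σ_j λ_iλ_j q(v_i − v_j)` with `q = p1Quad3 W`. -/
theorem p1_variance_identity (W : Fin 3 → Fin 3 → ℝ) (lam : Fin 4 → ℝ) (hlam : ∑ i, lam i = 1) (v : Fin 4 → Fin 3 → ℝ) :
    (∑ i, lam i * p1Quad3 W (v i)) - p1Quad3 W (fun k => ∑ i, lam i * v i k) =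
      1 / 2 * ∑ i, ∑ j, lam i * lam j * p1Quad3 W (v i - v j) := by
  simp only [Fin.sum_univ_four] at hlam ⊢
  simp only [p1Quad3_eq, Pi.sub_apply]
  have h3 : lam 3 = 1 - lam 0 - lam 1 - lam 2 := by linarith
  rw [h3]
  ring

/-- `p1Quad3` of a positive semidefinite table is nonnegative (hypothesis form). -/
theorem p1_jensen_quad (W : Fin 3 → Fin 3 → ℝ) (hW : ∀ w : Fin 3 → ℝ, 0 ≤ p1Quad3 W w) (lam : Fin 4 → ℝ) (hlam0 : ∀ i, 0 ≤ lam i)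
    (hlam : ∑ i, lam i = 1) (v : Fin 4 → Fin 3 → ℝ) :
    p1Quad3 W (fun k => ∑ i, lam i * v i k) ≤ ∑ i, lam i * p1Quad3 W (v i) := by
  have hid := p1_variance_identity W lam hlam v
  have hnn : 0 ≤ ∑ i, ∑ j, lam i * lam j * p1Quad3 W (v i - v j) :=
    Finset.sum_nonneg fun i _ => Finset.sum_nonneg fun j _ => mul_nonneg (mul_nonneg (hlam0 i) (hlam0 j)) (hW _)
  linarith

/-- Specialisation `W = I`: `p1Quad3 I v = v₀² + v₁² + v₂²` (`= fpSq v`). -/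
theorem p1Quad3_one (v : Fin 3 → ℝ) : p1Quad3 (fun k l => if k = l then 1 else 0) v = v 0 ^ 2 + v 1 ^ 2 + v 2 ^ 2 := by
  rw [p1Quad3_eq]
  simp
  ring

/-- Specialisation `W = d dᵀ`: `p1Quad3 (d⊗d) v = ⟪d,v⟫²` (`= fpDot d v ^ 2`). -/
theorem p1Quad3_rankOne (d v : Fin 3 → ℝ) : p1Quad3 (fun k l => d k * d l) v = (d 0 * v 0 + d 1 * v 1 + d 2 * v 2) ^ 2 := by
  rw [p1Quad3_eq]
  ring

/-- The rank-one table is positive semidefinite. -/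
theorem p1Quad3_rankOne_nonneg (d v : Fin 3 → ℝ) : 0 ≤ p1Quad3 (fun k l => d k * d l) v := by
  rw [p1Quad3_rankOne]; positivity

/-- The identity table is positive semidefinite. -/
theorem p1Quad3_one_nonneg (v : Fin 3 → ℝ) : 0 ≤ p1Quad3 (fun k l => if k = l then 1 else 0) v := by
  rw [p1Quad3_one]; positivity

/-- **Jensen for `|·|²` at a point of a cell**: `|Σλ_iv_i|² ≤ Σλ_i|v_i|²`. -/
theorem p1_jensen_sq (lam : Fin 4 → ℝ) (hlam0 : ∀ i, 0 ≤ lam i) (hlam : ∑ i, lam i = 1) (v : Fin 4 → Fin 3 → ℝ) :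
    (∑ i, lam i * v i 0) ^ 2 + (∑ i, lam i * v i 1) ^ 2 + (∑ i, lam i * v i 2) ^ 2 ≤ ∑ i, lam i * (v i 0 ^ 2 + v i 1 ^ 2 + v i 2 ^ 2) := by
  have h := p1_jensen_quad (fun k l => if k = l then 1 else 0) p1Quad3_one_nonneg lam hlam0 hlam v
  simp only [p1Quad3_one] at h
  exact h

/-- **The variance identity for `⟪d,·⟫²`** (radial bare weight at a point): exact defect in terms of edge differences. -/
theorem p1_variance_rankOne (d : Fin 3 → ℝ) (lam : Fin 4 → ℝ) (hlam : ∑ i, lam i = 1) (v : Fin 4 → Fin 3 → ℝ) :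
    (∑ i, lam i * (d 0 * v i 0 + d 1 * v i 1 + d 2 * v i 2) ^ 2) -
        (d 0 * (∑ i, lam i * v i 0) + d 1 * (∑ i, lam i * v i 1) + d 2 * (∑ i, lam i * v i 2)) ^ 2 =
      1 / 2 * ∑ i, ∑ j, lam i * lam j * (d 0 * (v i 0 - v j 0) + d 1 * (v i 1 - v j 1) + d 2 * (v i 2 - v j 2)) ^ 2 := by
  have h := p1_variance_identity (fun k l => d k * d l) lam hlam v
  simp only [p1Quad3_rankOne, Pi.sub_apply] at h
  exact h

end Summit.AtomisticToContinuum.Crystallization.Theorems.StrictSplittingRuleBirth
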